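import Summits.KontsevichZagierPeriods.KontsevichZagierPeriods.Theses.IsogenyCertificates

/-!
# `EffectiveXMapChains` (stmt-KontsevichZagierPeriods-10664) — negative knowledge, part 3: the algebraic mechanism of the x-map transfer

Support file for the crux `IsogenyCertificates.EffectiveXMapChains` (cdisprove seat; part 1 is
`Negative/CountedTransfer.lean`; this part is self-contained). For EVERY datum `(f, g, c)` (`c²·g·(f³ + A'fg² + B'g³) = P·W²`,
`W = f'g − fg' ≠ 0`): `c ≠ 0`, `g ≠ 0` are forced (`c_ne_zero_of_datum`, `g_ne_zero_of_wronskian_ne_zero`); pointwise over `ℝ`, `c²g⁴·P'(R) = P·W²` with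
`R = f/g` (`P'_comp_R_eq`); hence `P'(R x) > 0` off the zeros of `g·W` on `{P > 0}`
(`P'_comp_R_pos`), critical values and boundary images of `R` are roots of `P'`
(`P'_comp_R_eq_zero_of_W_eq_zero`, `P'_comp_R_eq_zero_of_P_eq_zero`), and the rule-2) integrand
identity `a/√P = (a/|c|)/√P'(R)·|W/g²|` holds (`cov_integrand_identity`). Consequence (the reason
the crux resists): the fibre multiplicity of `R|{P>0}` is constant on each component of `{P'>0}`
and every monotone piece maps onto a whole component, so the move count per datum is `O(N)`.

References: Washington, *Elliptic Curves* (2008), §2.9 (Remark 2.26); Kontsevich–Zagier,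
*Periods* (2001), §1.2 rule 2.
-/

noncomputable section

namespace Summit.KontsevichZagierPeriods.IsogenyCertificates.EffectiveXMapChainsNegative

open Polynomial Set MeasureTheory
open Literature.NumberTheory.Transcendental
open Summit.KontsevichZagierPeriods.KontsevichZagierPeriods.Theses.IsogenyCertificates
/-! ## §5 The algebraic mechanism behind the count holds for EVERY datum (why the plan resists)

Pointwise over `ℝ`: `c²·g(x)⁴·P'(R x) = P(x)·W(x)²` with `R = f/g`, `W = f'g − fg'`. Hence on
`{P > 0}` minus the zeros of `g·W` one has `P'(R x) > 0` (pieces map INTO `{P' > 0}`, and rule 2)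
applies with `|R'|/√P'(R) = |c|⁻¹/√P`), and at every cut point — a zero of `W` (critical point of
`R`) or a zero of `P` (boundary of `{P>0}`) with `g ≠ 0` — the value `R x` is a ROOT of `P'`; also
`R(∞)` (if finite) is a root of `P'` (degree count, not formalised). So the fibre multiplicity of
`R|{P>0}` is constant on each component of `{P'>0}` and every monotone piece maps onto a WHOLE
component: no recombination of overlapping image intervals is needed and the move count is `O(N)`
in the datum degree (the plan's `O(N²)` is generous). `c ≠ 0`, `g ≠ 0` are forced.
-/

section Mechanism

variable {A B A' B' : ℤ} {f g : ℚ[X]} {c : ℚ}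

/-! Throughout, a *datum* is `(f, g, c)` with `W = f'g − fg' ≠ 0` (hypothesis `hW`) and the x-map
identity `c²·g·(f³ + A'fg² + B'g³) = (X³+AX+B)·W²` (hypothesis `hI`), exactly as inlined in the crux. -/

/-- `g ≠ 0` is forced by `W ≠ 0`. [folklore] -/
theorem g_ne_zero_of_wronskian_ne_zero (hW : derivative f * g - f * derivative g ≠ 0) : g ≠ 0 := by
  rintro rfl
  exact hW (by simp)

/-- The cubic `X³ + AX + B` is not the zero polynomial. [folklore] -/
lemma cubic_ne_zero (A B : ℤ) : (X ^ 3 + C (A : ℚ) * X + C (B : ℚ) : ℚ[X]) ≠ 0 := by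
  have h3 : (X ^ 3 + C (A : ℚ) * X + C (B : ℚ) : ℚ[X]).coeff 3 = 1 := by
    simp only [coeff_add, coeff_X_pow, coeff_C_mul, coeff_X, coeff_C]
    norm_num
  intro h0
  rw [h0, coeff_zero] at h3
  exact zero_ne_one h3

/-- `c ≠ 0` is forced: `c = 0` would give `P·W² = 0`, hence `W = 0`. [folklore] -/
theorem c_ne_zero_of_datum (hW : derivative f * g - f * derivative g ≠ 0)
    (hI : C (c ^ 2) * g * (f ^ 3 + C (A' : ℚ) * f * g ^ 2 + C (B' : ℚ) * g ^ 3) =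
      (X ^ 3 + C (A : ℚ) * X + C (B : ℚ)) * (derivative f * g - f * derivative g) ^ 2) : c ≠ 0 := by
  rintro rfl
  simp only [ne_eq, OfNat.ofNat_ne_zero, not_false_eq_true, zero_pow, map_zero, zero_mul] at hI
  rcases mul_eq_zero.mp hI.symm with hP | hW2
  · exact cubic_ne_zero A B hP
  · exact hW (pow_eq_zero_iff two_ne_zero |>.mp hW2)

/-- **Pointwise identity over `ℝ`**: `c²·g(x)·(f³ + A'fg² + B'g³)(x) = P(x)·W(x)²`. [cite: Washington2008, §2.9 (Remark 2.26)] -/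
theorem xMapIdentity_aeval
    (hI : C (c ^ 2) * g * (f ^ 3 + C (A' : ℚ) * f * g ^ 2 + C (B' : ℚ) * g ^ 3) =
      (X ^ 3 + C (A : ℚ) * X + C (B : ℚ)) * (derivative f * g - f * derivative g) ^ 2) (x : ℝ) :
    (c : ℝ) ^ 2 * aeval x g *
        (aeval x f ^ 3 + (A' : ℝ) * aeval x f * aeval x g ^ 2 + (B' : ℝ) * aeval x g ^ 3) =
      (x ^ 3 + (A : ℝ) * x + (B : ℝ)) * aeval x (derivative f * g - f * derivative g) ^ 2 := by
  have := congrArg (aeval x) hI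
  simpa [map_mul, map_add, map_pow, aeval_C, aeval_X] using this

/-- `P'(R x) = P(x)·W(x)² / (c²·g(x)⁴)` with `R = f/g`, wherever `g(x) ≠ 0`. [cite: Washington2008, §2.9 (Remark 2.26)] -/
theorem P'_comp_R_eq
    (hI : C (c ^ 2) * g * (f ^ 3 + C (A' : ℚ) * f * g ^ 2 + C (B' : ℚ) * g ^ 3) =
      (X ^ 3 + C (A : ℚ) * X + C (B : ℚ)) * (derivative f * g - f * derivative g) ^ 2)
    (hc : c ≠ 0) {x : ℝ} (hg : aeval x g ≠ 0) :
    (aeval x f / aeval x g) ^ 3 + (A' : ℝ) * (aeval x f / aeval x g) + (B' : ℝ) =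
      (x ^ 3 + (A : ℝ) * x + (B : ℝ)) * aeval x (derivative f * g - f * derivative g) ^ 2 /
        ((c : ℝ) ^ 2 * aeval x g ^ 4) := by
  have hid := xMapIdentity_aeval hI x
  have hc' : (c : ℝ) ≠ 0 := by exact_mod_cast hc
  have hden : (c : ℝ) ^ 2 * aeval x g ^ 4 ≠ 0 := by positivity
  have key : (aeval x f / aeval x g) ^ 3 + (A' : ℝ) * (aeval x f / aeval x g) + (B' : ℝ) =
      (aeval x f ^ 3 + (A' : ℝ) * aeval x f * aeval x g ^ 2 + (B' : ℝ) * aeval x g ^ 3) /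
        aeval x g ^ 3 := by
    field_simp
  rw [key, div_eq_div_iff (pow_ne_zero 3 hg) hden]
  linear_combination aeval x g ^ 3 * hid

/-- **Pieces map into `{P' > 0}`**: on `{P > 0}` minus the zeros of `g·W`, `P'(R x) > 0`. [folklore] -/
theorem P'_comp_R_pos (hW : derivative f * g - f * derivative g ≠ 0)
    (hI : C (c ^ 2) * g * (f ^ 3 + C (A' : ℚ) * f * g ^ 2 + C (B' : ℚ) * g ^ 3) =
      (X ^ 3 + C (A : ℚ) * X + C (B : ℚ)) * (derivative f * g - f * derivative g) ^ 2)
    {x : ℝ} (hP : 0 < x ^ 3 + (A : ℝ) * x + (B : ℝ))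
    (hg : aeval x g ≠ 0) (hWx : aeval x (derivative f * g - f * derivative g) ≠ 0) :
    0 < (aeval x f / aeval x g) ^ 3 + (A' : ℝ) * (aeval x f / aeval x g) + (B' : ℝ) := by
  have hc : (c : ℝ) ≠ 0 := by exact_mod_cast c_ne_zero_of_datum hW hI
  rw [P'_comp_R_eq hI (c_ne_zero_of_datum hW hI) hg]
  positivity

/-- **Critical values of `R` are roots of `P'`** (so the fibre multiplicity cannot jump inside a
component of `{P' > 0}`). [folklore] -/
theorem P'_comp_R_eq_zero_of_W_eq_zero (hW : derivative f * g - f * derivative g ≠ 0)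
    (hI : C (c ^ 2) * g * (f ^ 3 + C (A' : ℚ) * f * g ^ 2 + C (B' : ℚ) * g ^ 3) =
      (X ^ 3 + C (A : ℚ) * X + C (B : ℚ)) * (derivative f * g - f * derivative g) ^ 2)
    {x : ℝ} (hg : aeval x g ≠ 0) (hWx : aeval x (derivative f * g - f * derivative g) = 0) :
    (aeval x f / aeval x g) ^ 3 + (A' : ℝ) * (aeval x f / aeval x g) + (B' : ℝ) = 0 := by
  rw [P'_comp_R_eq hI (c_ne_zero_of_datum hW hI) hg, hWx]
  simp

/-- **Boundary points of `{P > 0}` map to roots of `P'`** (images of the pieces END at 2-torsion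
abscissae of the target, i.e. pieces map onto whole components). [folklore] -/
theorem P'_comp_R_eq_zero_of_P_eq_zero (hW : derivative f * g - f * derivative g ≠ 0)
    (hI : C (c ^ 2) * g * (f ^ 3 + C (A' : ℚ) * f * g ^ 2 + C (B' : ℚ) * g ^ 3) =
      (X ^ 3 + C (A : ℚ) * X + C (B : ℚ)) * (derivative f * g - f * derivative g) ^ 2)
    {x : ℝ} (hg : aeval x g ≠ 0) (hP : x ^ 3 + (A : ℝ) * x + (B : ℝ) = 0) :
    (aeval x f / aeval x g) ^ 3 + (A' : ℝ) * (aeval x f / aeval x g) + (B' : ℝ) = 0 := by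
  rw [P'_comp_R_eq hI (c_ne_zero_of_datum hW hI) hg, hP]
  simp

/-- **The rule-2) integrand identity on a piece**: `a/√P(x) = (a/|c|)/√P'(R x) · |R'(x)|`,
`R' = W/g²` — exactly the hypothesis `f x = f' (Φ x) · |det Φ' x|` of `KZ.changeOfVariablesRel`. [cite: KontsevichZagier2001, §1.2 rule 2] -/
theorem cov_integrand_identity (hW : derivative f * g - f * derivative g ≠ 0)
    (hI : C (c ^ 2) * g * (f ^ 3 + C (A' : ℚ) * f * g ^ 2 + C (B' : ℚ) * g ^ 3) =
      (X ^ 3 + C (A : ℚ) * X + C (B : ℚ)) * (derivative f * g - f * derivative g) ^ 2)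
    {x : ℝ} (hP : 0 < x ^ 3 + (A : ℝ) * x + (B : ℝ)) (hg : aeval x g ≠ 0)
    (hWx : aeval x (derivative f * g - f * derivative g) ≠ 0) (a : ℝ) :
    a / Real.sqrt (x ^ 3 + (A : ℝ) * x + (B : ℝ)) =
      (a / |(c : ℝ)|) / Real.sqrt ((aeval x f / aeval x g) ^ 3 + (A' : ℝ) * (aeval x f / aeval x g)
          + (B' : ℝ)) *
        |aeval x (derivative f * g - f * derivative g) / aeval x g ^ 2| := by
  have hc : (c : ℝ) ≠ 0 := by exact_mod_cast c_ne_zero_of_datum hW hI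
  set P : ℝ := x ^ 3 + (A : ℝ) * x + (B : ℝ) with hPdef
  set Wx : ℝ := aeval x (derivative f * g - f * derivative g) with hWdef
  set gx : ℝ := aeval x g with hgdef
  rw [P'_comp_R_eq hI (c_ne_zero_of_datum hW hI) hg]
  have hsq : Real.sqrt (P * Wx ^ 2 / ((c : ℝ) ^ 2 * gx ^ 4)) = Real.sqrt P * |Wx| / (|(c : ℝ)| * gx ^ 2) := by
    rw [Real.sqrt_div' _ (by positivity), Real.sqrt_mul hP.le, Real.sqrt_sq_eq_abs,
      Real.sqrt_mul (sq_nonneg _), Real.sqrt_sq_eq_abs,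
      show gx ^ 4 = (gx ^ 2) ^ 2 by ring, Real.sqrt_sq (sq_nonneg _)]
  rw [hsq, abs_div, abs_of_nonneg (sq_nonneg gx)]
  have hsP : 0 < Real.sqrt P := Real.sqrt_pos.mpr hP
  have hWa : 0 < |Wx| := abs_pos.mpr hWx
  have hca : 0 < |(c : ℝ)| := abs_pos.mpr hc
  have hg2 : 0 < gx ^ 2 := by positivity
  field_simp

end Mechanism

end Summit.KontsevichZagierPeriods.IsogenyCertificates.EffectiveXMapChainsNegative
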